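import Summits.QuantumFields.BalabanUV.Beta.D1BFx.PackedCoframeSepKernels
import Summits.QuantumFields.BalabanUV.Beta.D1BFx.GluonNeedleSplit

/-!
# BetaPertH road «BF-x» — «COFRAME-MASS» M2: the plain masses of `k9Inf k5Inf k7Inf k4Inf` and of `cofPairInf`, with separation decay

STATUS: [folklore] `ℓ¹` bookkeeping for the road's (A1)-PACKED identity (BINDER row D1, slot (K)); NOT an estimate of Bałaban's, NOT a discharge of any
root-level binder.  Provenance: reconstruction; the manuscript(s) under audit are NOT citable.

WHAT.  For weights of envelopes `(C, δ, P)`, `(C′, δ, P′)` and the DISPLAYED letters `hG : Decays (Cgh n a) CG δ`, `hR : Decays (Rgt n a) CR δ`,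
`0 < δ ≤ 1`: `∃ K, ∀ P P′ w w′, (envelopes) → Summable ∧ Σ'_{(x,x′)} Σ_{αβ} |k•Inf n a w w′ x x′ α β| ≤ K·e^{−s•·|P−P′|₁}` with `s₉ = s₅ = δ∕8`,
`s₇ = s₄ = δ∕32` — from M1b's two-centre letters by `mass_le_of_biLoc₂` (16·K·Zl²) after `biLoc_sep_mono`, and M1's masses of sums ∕ differences
(§2 splits the `lapU∘Cgh ∘ l2WInf ∘ Cgh∘lapU` sandwich into its four chains by `comp_add_*_tame` over `Loc`∕`Spr` letters and `GluonNeedleSplit.dSw_add`); §3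
**`exists_mass_cofPairInf : ∃ K, ∀ P P′ w w′, (envelopes) → Summable ∧ Σ'_{(x,x′)} Σ_{αβ} |cofPairInf n a w w′ x x′ α β| ≤ K·e^{−(δ∕32)·|P−P′|₁}`** — ONE
constant for all centres and all weights of the given envelopes: THE `z`-DECAY MASS LETTER of the co-frame half of `ffW (W2NInf …)` (READ-OUT `ffW_W2NInf`)
once the road's weights get their envelope (gan24-leaf-05 `abs_colH_G₀_road_le`: `n⁻⁴·C_{G₀}`, rate `κ′∕(4n)`; `|P−P′|₁ = (m+1)|y−y′|₁` ⇒ n-free `z`-rate).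
The n-POWER of `K` is NOT displayed (the located unit-class question for the TB4-W co-frame words).
Unit `b2b-balaban-beta-d1-formalise-leaf-03` (gen 24); road owner `b2b-balaban-beta-d1-p2`.
-/

noncomputable section

namespace Summit.QuantumFields.BalabanUV.Beta.D1BFx.PackedCoframePairMass

open scoped BigOperators
open Literature.MathematicalPhysics.QuantumFieldTheory.Balaban1983to89
open Literature.MathematicalPhysics.QuantumFieldTheory.Balaban1983to89.Beta
open B12Sec2to5 (l1 l1_nonneg)
open ExpKernelCalculus (Site MKer BiLoc Decays comp Zl l1_sub_symm)
open Summit.QuantumFields.BalabanUV.Beta.TameKernelCalculus (Spr Loc Tame trK comp_add_right_tame comp_add_left_tame decays_of_le)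
open Summit.QuantumFields.BalabanUV.Beta.D1BFx.RJetProjector (Rgt)
open Summit.QuantumFields.BalabanUV.Beta.D1BFx.RJetAssembly (dSw)
open Summit.QuantumFields.BalabanUV.Beta.D1BFx.KGhostLeg (Cgh)
open Summit.QuantumFields.BalabanUV.Beta.D1BFx.TorusGhostWordArrays (lapU)
open Summit.QuantumFields.BalabanUV.Beta.D1BFx.PackedPinnedLetters (jetRw jetCw jetRCw)
open Summit.QuantumFields.BalabanUV.Beta.D1BFx.PackedCoframeSiteWords (gW qW d2W)
open Summit.QuantumFields.BalabanUV.Beta.D1BFx.PackedCoframePairLimit (l2WInf k9Inf k5Inf k7Inf k4Inf cofPairInf)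
open Summit.QuantumFields.BalabanUV.Beta.D1BFx.PackedCoframeSep (biLoc_sep_mono mass_le_of_biLoc₂ mass_add_le mass_sub_le mass_neg_eq mass_smul_le
  mass_trK)
open Summit.QuantumFields.BalabanUV.Beta.D1BFx.GluonNeedleSplit (dSw_add)
open Summit.QuantumFields.BalabanUV.Beta.D1BFx.PackedCoframeSepKernels (decays_LC decays_CL exists_biLoc_d2W_L_sep exists_biLoc_L_d2W_sep
  exists_biLoc_gW_gW_sep)
open Summit.QuantumFields.BalabanUV.Beta.D1BFx.PackedCoframeSepKernels (exists_biLoc_W1 exists_biLoc_W2 exists_biLoc_W4 exists_biLoc_W5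
  exists_biLoc_W6 exists_biLoc_W7 exists_biLoc_W8 exists_biLoc_W9 exists_biLoc_W10 exists_biLoc_W11a exists_biLoc_W11b exists_biLoc_W11d exists_biLoc_W12)

variable {n : ℕ} [NeZero n] {a : ℝ} {CG CR δ : ℝ}

omit [NeZero n] in
/-- [folklore] **MASS FROM A TWO-CENTRE LETTER WITH SEPARATION**: `BiLoc X p q (K·e^{−s·t}) ρ`, `0 < ρ`, `s₀ ≤ s`, `0 ≤ t` ⊢ summable and
`Σ'_{(x,x′)} Σ_{αβ} |X| ≤ (16·K·Zl 4 ρ²)·e^{−s₀·t}` (any centres). -/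
theorem mass_of_biLoc_sep {X : MKer 4 (Fin 4)} {p q : Site 4} {K s s₀ t ρ : ℝ} (h : BiLoc X p q (K * Real.exp (-s * t)) ρ)
    (hρ : 0 < ρ) (hs : s₀ ≤ s) (ht : 0 ≤ t) :
    (Summable fun pq : Site 4 × Site 4 => ∑ α, ∑ β, |X pq.1 pq.2 α β|) ∧
      ∑' pq : Site 4 × Site 4, ∑ α, ∑ β, |X pq.1 pq.2 α β| ≤ (16 * K * Zl 4 ρ ^ 2) * Real.exp (-s₀ * t) := by
  have hm := mass_le_of_biLoc₂ (biLoc_sep_mono h hs ht) hρ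
  refine ⟨hm.1, hm.2.trans_eq ?_⟩
  rw [Fintype.card_fin]
  push_cast
  ring

/-- [folklore] **THE MASS OF `k9Inf n a w w′`** (words W1, W2, W2-swapped, W4): `≤ K₉·e^{−(δ∕8)|P−P′|₁}`, ONE `K₉` for all centres and weights. -/
theorem exists_mass_k9Inf (hG : Decays (Cgh n a) CG δ) (hR : Decays (Rgt n a) CR δ) (hδ : 0 < δ) (hδ1 : δ ≤ 1) (C C' : ℝ) :
    ∃ K : ℝ, ∀ (P P' : Site 4) (w w' : Fin 4 → (Fin 4 → ℤ) → ℝ), (∀ κ u, |w κ u| ≤ C * Real.exp (-δ * l1 (u - P))) →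
      (∀ κ u, |w' κ u| ≤ C' * Real.exp (-δ * l1 (u - P'))) →
      (Summable fun pq : Site 4 × Site 4 => ∑ α, ∑ β, |k9Inf n a w w' pq.1 pq.2 α β|) ∧
        ∑' pq : Site 4 × Site 4, ∑ α, ∑ β, |k9Inf n a w w' pq.1 pq.2 α β| ≤ K * Real.exp (-(δ / 8) * l1 (P - P')) := by
  obtain ⟨K1, h1⟩ := exists_biLoc_W1 hG hδ hδ1 C C'
  obtain ⟨K2, h2⟩ := exists_biLoc_W2 hG hδ hδ1 C C'
  obtain ⟨K3, h3⟩ := exists_biLoc_W2 hG hδ hδ1 C' C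
  obtain ⟨K4, h4⟩ := exists_biLoc_W4 hR hδ C C'
  refine ⟨16 * K1 * Zl 4 (δ / 8) ^ 2 + 16 * K2 * Zl 4 (δ / 8) ^ 2 + 16 * K3 * Zl 4 (δ / 8) ^ 2 + 16 * K4 * Zl 4 (δ / 4) ^ 2,
    fun P P' w w' hw hw' => ?_⟩
  have ht : 0 ≤ l1 (P - P') := l1_nonneg _
  have m1 := mass_of_biLoc_sep (h1 P P' w w' hw hw') (by linarith) (by linarith : δ / 8 ≤ δ / 2) ht
  have m2 := mass_of_biLoc_sep (h2 P P' w w' hw hw') (by linarith) (le_refl (δ / 8)) ht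
  have h3' := h3 P' P w' w hw' hw
  rw [l1_sub_symm P' P] at h3'
  have m3 := mass_of_biLoc_sep h3' (by linarith) (le_refl (δ / 8)) ht
  have m4 := mass_of_biLoc_sep (h4 P P' w w' hw hw') (by linarith) (by linarith : δ / 8 ≤ δ / 2) ht
  have s12 := mass_sub_le m1.1 m2.1
  have s123 := mass_sub_le s12.1 m3.1
  have s1234 := mass_add_le s123.1 m4.1
  rw [k9Inf]
  refine ⟨s1234.1, ?_⟩
  have E0 := (Real.exp_pos (-(δ / 8) * l1 (P - P'))).le
  nlinarith [s1234.2, s123.2, s12.2, m1.2, m2.2, m3.2, m4.2]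

/-- [folklore] **THE MASS OF `k5Inf n a w w′`** (words W5, W6, W7, W8): `≤ K₅·e^{−(δ∕8)|P−P′|₁}`. -/
theorem exists_mass_k5Inf (hG : Decays (Cgh n a) CG δ) (hR : Decays (Rgt n a) CR δ) (hδ : 0 < δ) (hδ1 : δ ≤ 1) (C C' : ℝ) :
    ∃ K : ℝ, ∀ (P P' : Site 4) (w w' : Fin 4 → (Fin 4 → ℤ) → ℝ), (∀ κ u, |w κ u| ≤ C * Real.exp (-δ * l1 (u - P))) →
      (∀ κ u, |w' κ u| ≤ C' * Real.exp (-δ * l1 (u - P'))) →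
      (Summable fun pq : Site 4 × Site 4 => ∑ α, ∑ β, |k5Inf n a w w' pq.1 pq.2 α β|) ∧
        ∑' pq : Site 4 × Site 4, ∑ α, ∑ β, |k5Inf n a w w' pq.1 pq.2 α β| ≤ K * Real.exp (-(δ / 8) * l1 (P - P')) := by
  obtain ⟨K5, h5⟩ := exists_biLoc_W5 hG hδ C C'
  obtain ⟨K6, h6⟩ := exists_biLoc_W6 hG hδ hδ1 C C'
  obtain ⟨K7, h7⟩ := exists_biLoc_W7 hG hδ hδ1 C C'
  obtain ⟨K8, h8⟩ := exists_biLoc_W8 hR hδ C C'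
  refine ⟨16 * K5 * Zl 4 (δ / 4) ^ 2 + 16 * K6 * Zl 4 (δ / 8) ^ 2 + 16 * K7 * Zl 4 (δ / 8) ^ 2 + 16 * K8 * Zl 4 (δ / 2) ^ 2,
    fun P P' w w' hw hw' => ?_⟩
  have ht : 0 ≤ l1 (P - P') := l1_nonneg _
  have m5 := mass_of_biLoc_sep (h5 P P' w w' hw hw') (by linarith) (le_refl (δ / 8)) ht
  have m6 := mass_of_biLoc_sep (h6 P P' w w' hw hw') (by linarith) (le_refl (δ / 8)) ht
  have h7' := h7 P P' w w' hw hw'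
  rw [l1_sub_symm P' P] at h7'
  have m7 := mass_of_biLoc_sep h7' (by linarith) (le_refl (δ / 8)) ht
  have m8 := mass_of_biLoc_sep (h8 P P' w w' hw hw') (by linarith) (by linarith : δ / 8 ≤ δ / 2) ht
  have s56 := mass_sub_le m5.1 m6.1
  have s567 := mass_add_le s56.1 m7.1
  have s5678 := mass_sub_le s567.1 m8.1
  rw [k5Inf]
  refine ⟨s5678.1, ?_⟩
  have E0 := (Real.exp_pos (-(δ / 8) * l1 (P - P'))).le
  nlinarith [s5678.2, s567.2, s56.2, m5.2, m6.2, m7.2, m8.2]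

/-- [folklore] **THE MASS OF `k7Inf n a w w′`** (words W9, W10): `≤ K₇·e^{−(δ∕32)|P−P′|₁}` (the swapped table `k7Inf n a w′ w` is the same lemma
with `(C,P,w) ↔ (C′,P′,w′)`). -/
theorem exists_mass_k7Inf (hG : Decays (Cgh n a) CG δ) (hδ : 0 < δ) (hδ1 : δ ≤ 1) (C C' : ℝ) :
    ∃ K : ℝ, ∀ (P P' : Site 4) (w w' : Fin 4 → (Fin 4 → ℤ) → ℝ), (∀ κ u, |w κ u| ≤ C * Real.exp (-δ * l1 (u - P))) →
      (∀ κ u, |w' κ u| ≤ C' * Real.exp (-δ * l1 (u - P'))) →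
      (Summable fun pq : Site 4 × Site 4 => ∑ α, ∑ β, |k7Inf n a w w' pq.1 pq.2 α β|) ∧
        ∑' pq : Site 4 × Site 4, ∑ α, ∑ β, |k7Inf n a w w' pq.1 pq.2 α β| ≤ K * Real.exp (-(δ / 32) * l1 (P - P')) := by
  obtain ⟨K9, h9⟩ := exists_biLoc_W9 hG hδ hδ1 C C'
  obtain ⟨K10, h10⟩ := exists_biLoc_W10 hG hδ hδ1 C C'
  refine ⟨16 * K9 * Zl 4 (δ / 16) ^ 2 + 16 * K10 * Zl 4 (δ / 32) ^ 2, fun P P' w w' hw hw' => ?_⟩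
  have ht : 0 ≤ l1 (P - P') := l1_nonneg _
  have m9 := mass_of_biLoc_sep (h9 P P' w w' hw hw') (by linarith) (le_refl (δ / 32)) ht
  have m10 := mass_of_biLoc_sep (h10 P P' w w' hw hw') (by linarith) (le_refl (δ / 32)) ht
  have m9' : (Summable fun pq : Site 4 × Site 4 => ∑ α, ∑ β,
      |(-dSw (comp (comp (comp (comp lapU (Cgh n a)) (qW w)) (Cgh n a)) (gW w'))) pq.1 pq.2 α β|) ∧
      ∑' pq : Site 4 × Site 4, ∑ α, ∑ β, |(-dSw (comp (comp (comp (comp lapU (Cgh n a)) (qW w)) (Cgh n a)) (gW w'))) pq.1 pq.2 α β|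
        ≤ (16 * K9 * Zl 4 (δ / 16) ^ 2) * Real.exp (-(δ / 32) * l1 (P - P')) := by
    rw [mass_neg_eq]; exact m9
  have s := mass_add_le m9'.1 m10.1
  rw [k7Inf]
  refine ⟨s.1, ?_⟩
  have E0 := (Real.exp_pos (-(δ / 32) * l1 (P - P'))).le
  nlinarith [s.2, m9'.2, m10.2]

/-! ## §2 The `l2WInf` sandwich split and the mass of `k4Inf` -/

/-- [folklore] **THE SANDWICH SPLIT**: `dSw (LC ∘ l2WInf w w′ ∘ CL)` is the sum of the four chain words W11a + W11b + W11c + W11d (distributivity of `comp`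
over `+` for `Loc`∕`Spr` factors, `dSw_add`). -/
theorem dSw_LC_l2WInf_CL_eq (hG : Decays (Cgh n a) CG δ) (hδ : 0 < δ) (hδ1 : δ ≤ 1) {C C' : ℝ} {P P' : Site 4}
    {w w' : Fin 4 → (Fin 4 → ℤ) → ℝ} (hw : ∀ κ u, |w κ u| ≤ C * Real.exp (-δ * l1 (u - P)))
    (hw' : ∀ κ u, |w' κ u| ≤ C' * Real.exp (-δ * l1 (u - P'))) :
    dSw (comp (comp (comp lapU (Cgh n a)) (l2WInf w w')) (comp (Cgh n a) lapU))
      = dSw (comp (comp (comp lapU (Cgh n a)) (comp (d2W w w') lapU)) (comp (Cgh n a) lapU))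
        + dSw (comp (comp (comp lapU (Cgh n a)) (comp (gW w) (gW w'))) (comp (Cgh n a) lapU))
        + dSw (comp (comp (comp lapU (Cgh n a)) (comp (gW w') (gW w))) (comp (Cgh n a) lapU))
        + dSw (comp (comp (comp lapU (Cgh n a)) (comp lapU (d2W w w'))) (comp (Cgh n a) lapU)) := by
  -- the tame letters
  have hLC : Spr (comp lapU (Cgh n a)) := ⟨_, δ / 2, half_pos hδ, decays_LC hG hδ hδ1⟩
  have hCL : Spr (comp (Cgh n a) lapU) := ⟨_, δ / 2, half_pos hδ, decays_CL hG hδ hδ1⟩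
  obtain ⟨Ka, ha⟩ := exists_biLoc_d2W_L_sep hδ hδ1 C C'
  obtain ⟨Kb, hb⟩ := exists_biLoc_gW_gW_sep hδ C C'
  obtain ⟨Kc, hc⟩ := exists_biLoc_gW_gW_sep hδ C' C
  obtain ⟨Kd, hd⟩ := exists_biLoc_L_d2W_sep hδ hδ1 C C'
  have T1 : Loc (comp (d2W w w') lapU) := ⟨_, _, _, _, by linarith, ha P P' w w' hw hw'⟩
  have T2 : Loc (comp (gW w) (gW w')) := ⟨_, _, _, _, half_pos hδ, hb P P' w w' hw hw'⟩
  have T3 : Loc (comp (gW w') (gW w)) := ⟨_, _, _, _, half_pos hδ, hc P' P w' w hw' hw⟩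
  have T4 : Loc (comp lapU (d2W w w')) := ⟨_, _, _, _, by linarith, hd P P' w w' hw hw'⟩
  rw [l2WInf]
  rw [comp_add_right_tame hLC.tame ((T1.add T2).add T3).tame T4.tame, comp_add_right_tame hLC.tame (T1.add T2).tame T3.tame,
    comp_add_right_tame hLC.tame T1.tame T2.tame]
  have S1 := hLC.comp_loc T1
  have S2 := hLC.comp_loc T2
  have S3 := hLC.comp_loc T3
  have S4 := hLC.comp_loc T4
  rw [comp_add_left_tame ((S1.add S2).add S3).tame S4.tame hCL.tame, comp_add_left_tame (S1.add S2).tame S3.tame hCL.tame,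
    comp_add_left_tame S1.tame S2.tame hCL.tame, dSw_add, dSw_add, dSw_add]

/-- [folklore] **THE MASS OF `k4Inf n a w w′`** (W11a–d, W12, W12-swapped): `≤ K₄·e^{−(δ∕32)|P−P′|₁}`, ONE `K₄` for all centres and weights. -/
theorem exists_mass_k4Inf (hG : Decays (Cgh n a) CG δ) (hδ : 0 < δ) (hδ1 : δ ≤ 1) (C C' : ℝ) :
    ∃ K : ℝ, ∀ (P P' : Site 4) (w w' : Fin 4 → (Fin 4 → ℤ) → ℝ), (∀ κ u, |w κ u| ≤ C * Real.exp (-δ * l1 (u - P))) →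
      (∀ κ u, |w' κ u| ≤ C' * Real.exp (-δ * l1 (u - P'))) →
      (Summable fun pq : Site 4 × Site 4 => ∑ α, ∑ β, |k4Inf n a w w' pq.1 pq.2 α β|) ∧
        ∑' pq : Site 4 × Site 4, ∑ α, ∑ β, |k4Inf n a w w' pq.1 pq.2 α β| ≤ K * Real.exp (-(δ / 32) * l1 (P - P')) := by
  obtain ⟨Ka, ha⟩ := exists_biLoc_W11a hG hδ hδ1 C C'
  obtain ⟨Kb, hb⟩ := exists_biLoc_W11b hG hδ hδ1 C C'
  obtain ⟨Kc, hc⟩ := exists_biLoc_W11b hG hδ hδ1 C' C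
  obtain ⟨Kd, hd⟩ := exists_biLoc_W11d hG hδ hδ1 C C'
  obtain ⟨K12, h12⟩ := exists_biLoc_W12 hG hδ hδ1 C C'
  obtain ⟨K12', h12'⟩ := exists_biLoc_W12 hG hδ hδ1 C' C
  refine ⟨16 * Ka * Zl 4 (δ / 32) ^ 2 + 16 * Kb * Zl 4 (δ / 8) ^ 2 + 16 * Kc * Zl 4 (δ / 8) ^ 2 + 16 * Kd * Zl 4 (δ / 32) ^ 2
      + 16 * K12 * Zl 4 (δ / 32) ^ 2 + 16 * K12' * Zl 4 (δ / 32) ^ 2, fun P P' w w' hw hw' => ?_⟩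
  have ht : 0 ≤ l1 (P - P') := l1_nonneg _
  have ma := mass_of_biLoc_sep (ha P P' w w' hw hw') (by linarith) (by linarith : δ / 32 ≤ δ / 2) ht
  have mb := mass_of_biLoc_sep (hb P P' w w' hw hw') (by linarith) (by linarith : δ / 32 ≤ δ / 4) ht
  have hc' := hc P' P w' w hw' hw
  rw [l1_sub_symm P' P] at hc'
  have mc := mass_of_biLoc_sep hc' (by linarith) (by linarith : δ / 32 ≤ δ / 4) ht
  have md := mass_of_biLoc_sep (hd P P' w w' hw hw') (by linarith) (by linarith : δ / 32 ≤ δ / 2) ht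
  have m12 := mass_of_biLoc_sep (h12 P P' w w' hw hw') (by linarith) (le_refl (δ / 32)) ht
  have h12s := h12' P' P w' w hw' hw
  rw [l1_sub_symm P' P] at h12s
  have m12' := mass_of_biLoc_sep h12s (by linarith) (le_refl (δ / 32)) ht
  -- the sandwich word as the sum of four
  have sab := mass_add_le ma.1 mb.1
  have sabc := mass_add_le sab.1 mc.1
  have sabcd := mass_add_le sabc.1 md.1
  rw [← dSw_LC_l2WInf_CL_eq hG hδ hδ1 hw hw'] at sabcd
  have m11 : (Summable fun pq : Site 4 × Site 4 => ∑ α, ∑ β,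
      |(-dSw (comp (comp (comp lapU (Cgh n a)) (l2WInf w w')) (comp (Cgh n a) lapU))) pq.1 pq.2 α β|) ∧
      ∑' pq : Site 4 × Site 4, ∑ α, ∑ β, |(-dSw (comp (comp (comp lapU (Cgh n a)) (l2WInf w w')) (comp (Cgh n a) lapU))) pq.1 pq.2 α β|
        ≤ (16 * Ka * Zl 4 (δ / 32) ^ 2 + 16 * Kb * Zl 4 (δ / 8) ^ 2 + 16 * Kc * Zl 4 (δ / 8) ^ 2 + 16 * Kd * Zl 4 (δ / 32) ^ 2)
          * Real.exp (-(δ / 32) * l1 (P - P')) := by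
    rw [mass_neg_eq]
    refine ⟨sabcd.1, ?_⟩
    nlinarith [sabcd.2, sabc.2, sab.2, ma.2, mb.2, mc.2, md.2]
  have s1 := mass_add_le m11.1 m12.1
  have s2 := mass_add_le s1.1 m12'.1
  rw [k4Inf]
  refine ⟨s2.1, ?_⟩
  nlinarith [s2.2, s1.2, m11.2, m12.2, m12'.2]

/-! ## §3 The mass of the co-frame pair table -/

/-- [folklore] **«COFRAME-MASS» — THE PLAIN MASS OF `cofPairInf n a w w′` WITH SEPARATION DECAY, ONE CONSTANT FOR ALL CENTRES**:
`∃ K, ∀ P P′ w w′, (|w κ u| ≤ C·e^{−δ|u−P|₁}) → (|w′ κ u| ≤ C′·e^{−δ|u−P′|₁}) → Summable ∧ Σ'_{(x,x′)} Σ_{αβ} |cofPairInf n a w w′ x x′ α β| ≤ K·e^{−(δ∕32)·|P−P′|₁}`,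
under `hG : Decays (Cgh n a) CG δ`, `hR : Decays (Rgt n a) CR δ`, `0 < δ ≤ 1` (`cofPairInf = 2•(trK k9 + trK k7′ + trK k7 + k4 + k5 + trK k5 + k7 + k7′ + k9)`,
P4b; masses of the nine by §1 ∕ M2a, `mass_trK`, `mass_add_le`, `mass_smul_le`). -/
theorem exists_mass_cofPairInf (hG : Decays (Cgh n a) CG δ) (hR : Decays (Rgt n a) CR δ) (hδ : 0 < δ) (hδ1 : δ ≤ 1) (C C' : ℝ) :
    ∃ K : ℝ, ∀ (P P' : Site 4) (w w' : Fin 4 → (Fin 4 → ℤ) → ℝ), (∀ κ u, |w κ u| ≤ C * Real.exp (-δ * l1 (u - P))) →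
      (∀ κ u, |w' κ u| ≤ C' * Real.exp (-δ * l1 (u - P'))) →
      (Summable fun pq : Site 4 × Site 4 => ∑ α, ∑ β, |cofPairInf n a w w' pq.1 pq.2 α β|) ∧
        ∑' pq : Site 4 × Site 4, ∑ α, ∑ β, |cofPairInf n a w w' pq.1 pq.2 α β| ≤ K * Real.exp (-(δ / 32) * l1 (P - P')) := by
  obtain ⟨K9, h9⟩ := exists_mass_k9Inf hG hR hδ hδ1 C C'
  obtain ⟨K5, h5⟩ := exists_mass_k5Inf hG hR hδ hδ1 C C'
  obtain ⟨K7, h7⟩ := exists_mass_k7Inf hG hδ hδ1 C C'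
  obtain ⟨K7', h7'⟩ := exists_mass_k7Inf hG hδ hδ1 C' C
  obtain ⟨K4, h4⟩ := exists_mass_k4Inf hG hδ hδ1 C C'
  refine ⟨2 * (K9 + K7' + K7 + K4 + K5 + K5 + K7 + K7' + K9), fun P P' w w' hw hw' => ?_⟩
  have ht : 0 ≤ l1 (P - P') := l1_nonneg _
  have E0 := Real.exp_pos (-(δ / 32) * l1 (P - P'))
  -- the five masses at the common separation rate `δ/32`
  have e9 : Real.exp (-(δ / 8) * l1 (P - P')) ≤ Real.exp (-(δ / 32) * l1 (P - P')) := Real.exp_le_exp.mpr (by nlinarith)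
  have m9 := h9 P P' w w' hw hw'
  have m5 := h5 P P' w w' hw hw'
  have m7 := h7 P P' w w' hw hw'
  have m7s := h7' P' P w' w hw' hw
  rw [l1_sub_symm P' P] at m7s
  have m4 := h4 P P' w w' hw hw'
  have hK9 : 0 ≤ K9 := le_of_mul_le_mul_right (by
    have := m9.2.trans' (tsum_nonneg fun pq => Finset.sum_nonneg fun α _ => Finset.sum_nonneg fun β _ => abs_nonneg _)
    rwa [zero_mul]) (Real.exp_pos (-(δ / 8) * l1 (P - P')))
  have hK5 : 0 ≤ K5 := le_of_mul_le_mul_right (by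
    have := m5.2.trans' (tsum_nonneg fun pq => Finset.sum_nonneg fun α _ => Finset.sum_nonneg fun β _ => abs_nonneg _)
    rwa [zero_mul]) (Real.exp_pos (-(δ / 8) * l1 (P - P')))
  have b9 : ∑' pq : Site 4 × Site 4, ∑ α, ∑ β, |k9Inf n a w w' pq.1 pq.2 α β| ≤ K9 * Real.exp (-(δ / 32) * l1 (P - P')) :=
    m9.2.trans (mul_le_mul_of_nonneg_left e9 hK9)
  have b5 : ∑' pq : Site 4 × Site 4, ∑ α, ∑ β, |k5Inf n a w w' pq.1 pq.2 α β| ≤ K5 * Real.exp (-(δ / 32) * l1 (P - P')) :=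
    m5.2.trans (mul_le_mul_of_nonneg_left e9 hK5)
  -- transposes
  have t9 := mass_trK m9.1
  have t7s := mass_trK m7s.1
  have t7 := mass_trK m7.1
  have t5 := mass_trK m5.1
  -- the eight additions, left-associated as in `cofPairInf`
  have a1 := mass_add_le t9.1 t7s.1
  have a2 := mass_add_le a1.1 t7.1
  have a3 := mass_add_le a2.1 m4.1
  have a4 := mass_add_le a3.1 m5.1
  have a5 := mass_add_le a4.1 t5.1
  have a6 := mass_add_le a5.1 m7.1
  have a7 := mass_add_le a6.1 m7s.1
  have a8 := mass_add_le a7.1 m9.1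
  have sm := mass_smul_le (2 : ℝ) a8.1
  rw [cofPairInf]
  refine ⟨sm.1, ?_⟩
  rw [sm.2, abs_of_pos (by norm_num : (0 : ℝ) < 2)]
  nlinarith [a8.2, a7.2, a6.2, a5.2, a4.2, a3.2, a2.2, a1.2, t9.2, t7s.2, t7.2, t5.2, b9, b5, m7.2, m7s.2, m4.2]


end Summit.QuantumFields.BalabanUV.Beta.D1BFx.PackedCoframePairMass

end
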